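import Summits.NavierStokesRegularity.NavierStokesRegularity.Theorems.SymmetryModuliCountSymmetricLiouvilleAncientOseenBound
import Summits.NavierStokesRegularity.NavierStokesRegularity.Theorems.ExtremiserTransienceLocalKatoGapKernel
import HarnessLib

/-!
# The localised Kato gap for Type-I ancient mild fields, II: the point estimate

Summits-side theorem file (kind = proof, no definitions): the analytic core of the localised Kato gap
(`ExtremiserTransienceLocalKatoGap.lean`; rungs of LINE g9-β `filament_selection` on crux
stmt-NavierStokesRegularity-26567). All sources of the ANCIENT OSEEN INEQUALITY
`‖u(τ,y)‖ ≤ C₀∫_{σ<τ}∫(τ−σ+‖y−z‖²)^{-2}‖u(σ,z)‖²` (tree: `SymmetryModuliCountSymmetricLiouville.stub_ancientOseenBound`)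
at a point `y` of the affinely shrinking zone `‖y − x₀‖ ≤ R(τ) = ρa/2 − (ρ/(12a))(τ + 4a²)`, `τ ∈ [−4a², −a²]`,
are split and bounded:

* `slice_old` — times `σ < −N²a²`, Type-I bound only: `c₃C²(τ−σ)^{-1/2}(−σ)⁻¹`;
* `slice_mid` — hypothesis times `σ ∈ [−N²a², −4a²)`: inside the hypothesis ball the weight `ε²(−σ)⁻¹` (kept
  un-integrated, to be fed to the tree's `stub_kernelTimeWeightIntegral`), outside `2c₃C²/(ρa³)`;
* `slice_boot` — bootstrap times `σ ∈ [−4a², τ)`: inside the zone the bootstrap level `η`, outside the affine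
  separation `v(τ−σ)`: `c₃η²(τ−σ)^{-1/2} + (4c₃C²/a²)(2v)^{-1/2}(τ−σ)^{-3/4}`;
* `pointEstimate` — the time integrals and the assembly:
  `‖u(τ,y)‖ ≤ C₀(2√2c₃C²/(Na) + ε²A/a + 2c₃C²N²/(ρa) + 4c₃η²a + 32√6c₃C²/(√ρa))`.

References: Koch–Nadirashvili–Seregin–Šverák, Acta Math. 203 (2009) = arXiv:0709.3599, §4 ((3.8), (4.3)–(4.4)).
-/

noncomputable section

set_option linter.dupNamespace false

open Set Function Filter MeasureTheory Metric
open scoped Topology ENNReal NNReal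
open Literature.Analysis Literature.Analysis.FluidPDE
open Summit.NavierStokesRegularity.NavierStokesRegularity.Theorems.SymmetryModuliCountSymmetricLiouville

namespace Summit.NavierStokesRegularity.NavierStokesRegularity.Theorems.NearExtremalTransiencePerFlow.LocalKatoGap


/-! ## The three kinds of time slices -/

/-- **Old time slice** (`σ < τ`, `σ < 0`; Type-I bound only):
`∫(τ−σ+‖y−z‖²)^{-2}‖u(σ,z)‖²dz ≤ c₃C²(τ−σ)^{-1/2}(−σ)⁻¹`. -/
theorem slice_old {C τ σ : ℝ} {u : ℝ → EuclideanSpace ℝ (Fin 3) → EuclideanSpace ℝ (Fin 3)} (y : EuclideanSpace ℝ (Fin 3))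
    (hTypeI : ∀ σ < 0, ∀ z : EuclideanSpace ℝ (Fin 3), ‖u σ z‖ ≤ C / Real.sqrt (-σ)) (hστ : σ < τ) (hσ0 : σ < 0) :
    ∫⁻ z, ENNReal.ofReal ((τ - σ + ‖y - z‖ ^ 2)⁻¹ ^ 2 * ‖u σ z‖ ^ 2) ≤
      ENNReal.ofReal ((∫ v : EuclideanSpace ℝ (Fin 3), (1 + ‖v‖ ^ 2) ^ (-(2 : ℝ))) * C ^ 2 * (τ - σ) ^ (-(1 / 2 : ℝ)) * (-σ)⁻¹) := by
  have hc₃ : 0 < (∫ v : EuclideanSpace ℝ (Fin 3), (1 + ‖v‖ ^ 2) ^ (-(2 : ℝ))) := c₃_pos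
  have hnear : ∀ z : EuclideanSpace ℝ (Fin 3), True → ‖u σ z‖ ^ 2 ≤ C ^ 2 * (-σ)⁻¹ := by
    intro z _
    have h := hTypeI σ hσ0 z
    calc ‖u σ z‖ ^ 2 ≤ (C / Real.sqrt (-σ)) ^ 2 := pow_le_pow_left₀ (norm_nonneg _) h 2
      _ = C ^ 2 * (-σ)⁻¹ := by
          rw [div_pow, Real.sq_sqrt (by linarith)]; ring
  have h := lintegral_slice_le (sub_pos.2 hστ) y (u σ) (fun _ => True) (sq_nonneg C)
    le_rfl hnear (fun z hz => (hz trivial).elim) (w := (-σ)⁻¹) (b := 0) (g := 0)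
  refine h.trans ?_
  rw [lintegral_kernelSq_mul_const (sub_pos.2 hστ) ((-σ)⁻¹) y]
  have e : ENNReal.ofReal (4 * (∫ v : EuclideanSpace ℝ (Fin 3), (1 + ‖v‖ ^ 2) ^ (-(2 : ℝ))) * (τ - σ + (0 : ℝ) ^ 2) ^ (-(1 / 2 : ℝ)) * (0 : ℝ) ^ 2) = 0 := by
    simp
  rw [e, add_zero,
    ← ENNReal.ofReal_mul (by positivity : (0 : ℝ) ≤ (∫ v : EuclideanSpace ℝ (Fin 3), (1 + ‖v‖ ^ 2) ^ (-(2 : ℝ))) * (τ - σ) ^ (-(1 / 2 : ℝ))),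
    ← ENNReal.ofReal_mul (sq_nonneg C)]
  refine ENNReal.ofReal_le_ofReal (le_of_eq ?_)
  ring

/-- **Hypothesis time slice** (`σ < τ`, `4a² < −σ`): inside the hypothesis ball `‖z − x₀‖ ≤ ρa` use
`‖u‖² ≤ ε²(−σ)⁻¹`, outside use the Type-I bound `‖u‖ ≤ C/(2a)` and the distance `≥ ρa/2` from the point `y`
(`‖y − x₀‖ ≤ ρa/2`): the slice integral is at most `ε²·∫(τ−σ+‖y−z‖²)^{-2}(−σ)⁻¹dz + 2c₃C²/(ρa³)`. -/
theorem slice_mid {C ε a ρ τ σ : ℝ} {u : ℝ → EuclideanSpace ℝ (Fin 3) → EuclideanSpace ℝ (Fin 3)} {x₀ y : EuclideanSpace ℝ (Fin 3)} (hC : 0 ≤ C) (ha : 0 < a) (hρ : 0 < ρ)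
    (hTypeI : ∀ σ < 0, ∀ z : EuclideanSpace ℝ (Fin 3), ‖u σ z‖ ≤ C / Real.sqrt (-σ)) (hστ : σ < τ) (hσ4 : 4 * a ^ 2 < -σ)
    (hy : ‖y - x₀‖ ≤ ρ * a / 2)
    (hhypσ : ∀ z : EuclideanSpace ℝ (Fin 3), ‖z - x₀‖ ≤ ρ * a → ‖u σ z‖ ^ 2 ≤ ε ^ 2 * (-σ)⁻¹) :
    ∫⁻ z, ENNReal.ofReal ((τ - σ + ‖y - z‖ ^ 2)⁻¹ ^ 2 * ‖u σ z‖ ^ 2) ≤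
      ENNReal.ofReal (ε ^ 2) * (∫⁻ z, ENNReal.ofReal ((τ - σ + ‖y - z‖ ^ 2)⁻¹ ^ 2 * (-σ)⁻¹)) +
        ENNReal.ofReal (2 * (∫ v : EuclideanSpace ℝ (Fin 3), (1 + ‖v‖ ^ 2) ^ (-(2 : ℝ))) * C ^ 2 / (ρ * a ^ 3)) := by
  have hc₃ : 0 < (∫ v : EuclideanSpace ℝ (Fin 3), (1 + ‖v‖ ^ 2) ^ (-(2 : ℝ))) := c₃_pos
  have hσ0 : σ < 0 := by nlinarith
  have hfar : ∀ z : EuclideanSpace ℝ (Fin 3), ¬ ‖z - x₀‖ ≤ ρ * a → ‖u σ z‖ ≤ C / (2 * a) ∧ ρ * a / 2 ≤ ‖y - z‖ := by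
    intro z hz
    rw [not_le] at hz
    constructor
    · refine (hTypeI σ hσ0 z).trans ?_
      have h2a : 2 * a ≤ Real.sqrt (-σ) := by
        rw [show 2 * a = Real.sqrt ((2 * a) ^ 2) by rw [Real.sqrt_sq (by positivity)]]
        exact Real.sqrt_le_sqrt (by nlinarith)
      exact div_le_div_of_nonneg_left hC (by positivity) h2a
    · have htri : ‖z - x₀‖ ≤ ‖y - z‖ + ‖y - x₀‖ := by
        calc ‖z - x₀‖ = ‖(y - x₀) - (y - z)‖ := by congr 1; abel
          _ ≤ ‖y - x₀‖ + ‖y - z‖ := norm_sub_le _ _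
          _ = ‖y - z‖ + ‖y - x₀‖ := add_comm _ _
      linarith
  have h := lintegral_slice_le (sub_pos.2 hστ) y (u σ) (fun z => ‖z - x₀‖ ≤ ρ * a) (sq_nonneg ε)
    (by positivity : (0 : ℝ) ≤ ρ * a / 2) hhypσ hfar
  refine h.trans (add_le_add le_rfl (ENNReal.ofReal_le_ofReal ?_))
  -- `4 c₃ (τ−σ+g²)^{-1/2} (C/(2a))² ≤ 2 c₃ C²/(ρ a³)` with `g = ρa/2`
  have hg2 : 0 < (ρ * a / 2) ^ 2 := by positivity
  have hker : (τ - σ + (ρ * a / 2) ^ 2) ^ (-(1 / 2 : ℝ)) ≤ ((ρ * a / 2) ^ 2) ^ (-(1 / 2 : ℝ)) :=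
    Real.rpow_le_rpow_of_nonpos hg2 (by linarith) (by norm_num)
  have hev : ((ρ * a / 2) ^ 2) ^ (-(1 / 2 : ℝ)) = (ρ * a / 2)⁻¹ := by
    rw [Real.rpow_neg (by positivity), ← Real.sqrt_eq_rpow, Real.sqrt_sq (by positivity)]
  rw [hev] at hker
  calc 4 * (∫ v : EuclideanSpace ℝ (Fin 3), (1 + ‖v‖ ^ 2) ^ (-(2 : ℝ))) * (τ - σ + (ρ * a / 2) ^ 2) ^ (-(1 / 2 : ℝ)) * (C / (2 * a)) ^ 2
      ≤ 4 * (∫ v : EuclideanSpace ℝ (Fin 3), (1 + ‖v‖ ^ 2) ^ (-(2 : ℝ))) * (ρ * a / 2)⁻¹ * (C / (2 * a)) ^ 2 := by gcongr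
    _ = 2 * (∫ v : EuclideanSpace ℝ (Fin 3), (1 + ‖v‖ ^ 2) ^ (-(2 : ℝ))) * C ^ 2 / (ρ * a ^ 3) := by field_simp; ring

/-- **Bootstrap time slice** (`σ < τ`, `a² < −σ`): inside the zone at time `σ` (`‖z − x₀‖ ≤ Rσ`) use the
bootstrap bound `‖u‖ ≤ η`, outside use `‖u‖ ≤ C/a` and the AFFINE SEPARATION `Rσ − Rτ = v(τ − σ)` from the
point `y` of the zone at time `τ`: the slice integral is at most
`c₃η²(τ−σ)^{-1/2} + (4c₃C²/a²)(2v)^{-1/2}(τ−σ)^{-3/4}`. -/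
theorem slice_boot {C η a v Rσ Rτ τ σ : ℝ} {u : ℝ → EuclideanSpace ℝ (Fin 3) → EuclideanSpace ℝ (Fin 3)} {x₀ y : EuclideanSpace ℝ (Fin 3)} (hC : 0 ≤ C) (ha : 0 < a)
    (hv : 0 < v) (hTypeI : ∀ σ < 0, ∀ z : EuclideanSpace ℝ (Fin 3), ‖u σ z‖ ≤ C / Real.sqrt (-σ)) (hστ : σ < τ)
    (hσa : a ^ 2 < -σ) (hy : ‖y - x₀‖ ≤ Rτ) (hR : Rσ - Rτ = v * (τ - σ))
    (hbootσ : ∀ z : EuclideanSpace ℝ (Fin 3), ‖z - x₀‖ ≤ Rσ → ‖u σ z‖ ≤ η) :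
    ∫⁻ z, ENNReal.ofReal ((τ - σ + ‖y - z‖ ^ 2)⁻¹ ^ 2 * ‖u σ z‖ ^ 2) ≤
      ENNReal.ofReal ((∫ v : EuclideanSpace ℝ (Fin 3), (1 + ‖v‖ ^ 2) ^ (-(2 : ℝ))) * η ^ 2 * (τ - σ) ^ (-(1 / 2 : ℝ))) +
        ENNReal.ofReal (4 * (∫ v : EuclideanSpace ℝ (Fin 3), (1 + ‖v‖ ^ 2) ^ (-(2 : ℝ))) * C ^ 2 / a ^ 2 * (2 * v) ^ (-(1 / 2 : ℝ)) * (τ - σ) ^ (-(3 / 4 : ℝ))) := by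
  have hc₃ : 0 < (∫ v : EuclideanSpace ℝ (Fin 3), (1 + ‖v‖ ^ 2) ^ (-(2 : ℝ))) := c₃_pos
  have hσ0 : σ < 0 := by nlinarith
  have hθ : 0 < τ - σ := sub_pos.2 hστ
  have hnear : ∀ z : EuclideanSpace ℝ (Fin 3), ‖z - x₀‖ ≤ Rσ → ‖u σ z‖ ^ 2 ≤ η ^ 2 * 1 := by
    intro z hz
    rw [mul_one]
    exact pow_le_pow_left₀ (norm_nonneg _) (hbootσ z hz) 2
  have hfar : ∀ z : EuclideanSpace ℝ (Fin 3), ¬ ‖z - x₀‖ ≤ Rσ → ‖u σ z‖ ≤ C / a ∧ v * (τ - σ) ≤ ‖y - z‖ := by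
    intro z hz
    rw [not_le] at hz
    constructor
    · refine (hTypeI σ hσ0 z).trans ?_
      have h2a : a ≤ Real.sqrt (-σ) := by
        rw [show a = Real.sqrt (a ^ 2) by rw [Real.sqrt_sq ha.le]]
        exact Real.sqrt_le_sqrt hσa.le
      exact div_le_div_of_nonneg_left hC ha h2a
    · have htri : ‖z - x₀‖ ≤ ‖y - z‖ + ‖y - x₀‖ := by
        calc ‖z - x₀‖ = ‖(y - x₀) - (y - z)‖ := by congr 1; abel
          _ ≤ ‖y - x₀‖ + ‖y - z‖ := norm_sub_le _ _
          _ = ‖y - z‖ + ‖y - x₀‖ := add_comm _ _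
      linarith
  have h := lintegral_slice_le hθ y (u σ) (fun z => ‖z - x₀‖ ≤ Rσ) (sq_nonneg η)
    (by positivity : (0 : ℝ) ≤ v * (τ - σ)) hnear hfar
  refine h.trans ?_
  rw [lintegral_kernelSq_mul_const hθ 1 y, ENNReal.ofReal_one, mul_one,
    ← ENNReal.ofReal_mul (sq_nonneg η)]
  refine add_le_add (ENNReal.ofReal_le_ofReal (le_of_eq (by ring))) (ENNReal.ofReal_le_ofReal ?_)
  have hk := rpow_neg_half_add_sq_le hθ hv
  calc 4 * (∫ v : EuclideanSpace ℝ (Fin 3), (1 + ‖v‖ ^ 2) ^ (-(2 : ℝ))) * (τ - σ + (v * (τ - σ)) ^ 2) ^ (-(1 / 2 : ℝ)) * (C / a) ^ 2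
      ≤ 4 * (∫ v : EuclideanSpace ℝ (Fin 3), (1 + ‖v‖ ^ 2) ^ (-(2 : ℝ))) * ((2 * v) ^ (-(1 / 2 : ℝ)) * (τ - σ) ^ (-(3 / 4 : ℝ))) * (C / a) ^ 2 := by gcongr
    _ = 4 * (∫ v : EuclideanSpace ℝ (Fin 3), (1 + ‖v‖ ^ 2) ^ (-(2 : ℝ))) * C ^ 2 / a ^ 2 * (2 * v) ^ (-(1 / 2 : ℝ)) * (τ - σ) ^ (-(3 / 4 : ℝ)) := by
        field_simp

/-- Time integral of `k·(τ−σ)^{-1/2}` over `σ ∈ [s₀, τ)` with `τ − s₀ ≤ B`: at most `k·2√B`. -/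
theorem lintegral_Ico_rpow_neg_half_le {k s₀ τ B : ℝ} (hk : 0 ≤ k) (hB : 0 < B) (hτ : τ - s₀ ≤ B) :
    ∫⁻ σ in Ico s₀ τ, ENNReal.ofReal (k * (τ - σ) ^ (-(1 / 2 : ℝ))) ≤
      ENNReal.ofReal (k * (2 * Real.sqrt B)) := by
  rw [setLIntegral_Ico_comp_sub_left (fun θ => ENNReal.ofReal (k * θ ^ (-(1 / 2 : ℝ)))) s₀ τ]
  calc ∫⁻ θ in Ioc 0 (τ - s₀), ENNReal.ofReal (k * θ ^ (-(1 / 2 : ℝ)))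
      ≤ ∫⁻ θ in Ioc 0 B, ENNReal.ofReal (k * θ ^ (-(1 / 2 : ℝ))) := lintegral_mono_set (Ioc_subset_Ioc_right hτ)
    _ = ∫⁻ θ in Ioc 0 B, ENNReal.ofReal k * ENNReal.ofReal (θ ^ (-(1 / 2 : ℝ))) := by
        refine setLIntegral_congr_fun measurableSet_Ioc fun θ _ => ?_
        rw [← ENNReal.ofReal_mul hk]
    _ = ENNReal.ofReal k * ENNReal.ofReal (2 * Real.sqrt B) := by
        rw [lintegral_const_mul' _ _ ENNReal.ofReal_ne_top, setLIntegral_Ioc_rpow_neg_half hB]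
    _ = ENNReal.ofReal (k * (2 * Real.sqrt B)) := by rw [← ENNReal.ofReal_mul hk]

/-- Time integral of `K·(τ−σ)^{-3/4}` over `σ ∈ [s₀, τ)` with `τ − s₀ ≤ B`: at most `K·4B^{1/4}`. -/
theorem lintegral_Ico_rpow_neg_three_quarters_le {K s₀ τ B : ℝ} (hK : 0 ≤ K) (hB : 0 < B)
    (hτ : τ - s₀ ≤ B) :
    ∫⁻ σ in Ico s₀ τ, ENNReal.ofReal (K * (τ - σ) ^ (-(3 / 4 : ℝ))) ≤
      ENNReal.ofReal (K * (4 * B ^ (1 / 4 : ℝ))) := by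
  rw [setLIntegral_Ico_comp_sub_left (fun θ => ENNReal.ofReal (K * θ ^ (-(3 / 4 : ℝ)))) s₀ τ]
  calc ∫⁻ θ in Ioc 0 (τ - s₀), ENNReal.ofReal (K * θ ^ (-(3 / 4 : ℝ)))
      ≤ ∫⁻ θ in Ioc 0 B, ENNReal.ofReal (K * θ ^ (-(3 / 4 : ℝ))) := lintegral_mono_set (Ioc_subset_Ioc_right hτ)
    _ = ∫⁻ θ in Ioc 0 B, ENNReal.ofReal K * ENNReal.ofReal (θ ^ (-(3 / 4 : ℝ))) := by
        refine setLIntegral_congr_fun measurableSet_Ioc fun θ _ => ?_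
        rw [← ENNReal.ofReal_mul hK]
    _ = ENNReal.ofReal K * ENNReal.ofReal (4 * B ^ (1 / 4 : ℝ)) := by
        rw [lintegral_const_mul' _ _ ENNReal.ofReal_ne_top, setLIntegral_Ioc_rpow_neg_three_quarters hB]
    _ = ENNReal.ofReal (K * (4 * B ^ (1 / 4 : ℝ))) := by rw [← ENNReal.ofReal_mul hK]

/-- **The point estimate (all sources split).** Data: the ancient Oseen inequality with constant `C₀` and the
kernel/time-weight bound with constant `A` (both from the tree, taken as hypotheses here), the Type-I bound with
constant `C`, a scale `a > 0` (so the target time is `t₀ = −a²`), `N ≥ 3`, `ρ > 0`, the smallness hypothesis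
`‖u(σ,z)‖² ≤ ε²(−σ)⁻¹` on the earlier cylinder `σ ∈ [−N²a², −4a²)`, `‖z − x₀‖ ≤ ρa`, and the bootstrap bound
`‖u(σ,z)‖ ≤ η` on the shrinking zone `‖z − x₀‖ ≤ R(σ) = ρa/2 − (ρ/(12a))(σ + 4a²)` for `σ ∈ [−4a², τ)`.
Conclusion, at a time `τ ∈ [−4a², −a²]` and a point `y` of the zone at time `τ`:
`‖u(τ,y)‖ ≤ C₀·(2√2c₃C²/(Na) + ε²A/a + 2c₃C²N²/(ρa) + 4c₃η²a + 32√6·c₃C²/(√ρ·a))`. -/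
theorem pointEstimate {C₀ A C ε η a ρ N τ : ℝ} {u : ℝ → EuclideanSpace ℝ (Fin 3) → EuclideanSpace ℝ (Fin 3)} {x₀ y : EuclideanSpace ℝ (Fin 3)}
    (hC₀ : 0 < C₀) (hA : 0 < A) (hC : 0 ≤ C) (ha : 0 < a) (hN : 3 ≤ N) (hρ : 0 < ρ)
    (hOseen : ∀ t < 0, ∀ x : EuclideanSpace ℝ (Fin 3), ENNReal.ofReal ‖u t x‖ ≤ ENNReal.ofReal C₀ *
      ∫⁻ σ in Iio t, ∫⁻ z, ENNReal.ofReal ((t - σ + ‖x - z‖ ^ 2)⁻¹ ^ 2 * ‖u σ z‖ ^ 2))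
    (hT2 : ∀ t < 0, ∀ x : EuclideanSpace ℝ (Fin 3),
      ∫⁻ σ in Iio t, ∫⁻ z, ENNReal.ofReal ((t - σ + ‖x - z‖ ^ 2)⁻¹ ^ 2 * (-σ)⁻¹) ≤
        ENNReal.ofReal (A / Real.sqrt (-t)))
    (hTypeI : ∀ σ < 0, ∀ z : EuclideanSpace ℝ (Fin 3), ‖u σ z‖ ≤ C / Real.sqrt (-σ))
    (hτ₁ : -(4 * a ^ 2) ≤ τ) (hτ₂ : τ ≤ -a ^ 2)
    (hy : ‖y - x₀‖ ≤ ρ * a / 2 - ρ / (12 * a) * (τ + 4 * a ^ 2))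
    (hhyp : ∀ σ, -(N ^ 2 * a ^ 2) ≤ σ → σ < -(4 * a ^ 2) → ∀ z : EuclideanSpace ℝ (Fin 3), ‖z - x₀‖ ≤ ρ * a →
      ‖u σ z‖ ^ 2 ≤ ε ^ 2 * (-σ)⁻¹)
    (hboot : ∀ σ, -(4 * a ^ 2) ≤ σ → σ < τ → ∀ z : EuclideanSpace ℝ (Fin 3),
      ‖z - x₀‖ ≤ ρ * a / 2 - ρ / (12 * a) * (σ + 4 * a ^ 2) → ‖u σ z‖ ≤ η) :
    ‖u τ y‖ ≤ C₀ * (2 * Real.sqrt 2 * (∫ v : EuclideanSpace ℝ (Fin 3), (1 + ‖v‖ ^ 2) ^ (-(2 : ℝ))) * C ^ 2 / (N * a) + ε ^ 2 * A / a +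
      2 * (∫ v : EuclideanSpace ℝ (Fin 3), (1 + ‖v‖ ^ 2) ^ (-(2 : ℝ))) * C ^ 2 * N ^ 2 / (ρ * a) + 4 * (∫ v : EuclideanSpace ℝ (Fin 3), (1 + ‖v‖ ^ 2) ^ (-(2 : ℝ))) * η ^ 2 * a +
      32 * Real.sqrt 6 * (∫ v : EuclideanSpace ℝ (Fin 3), (1 + ‖v‖ ^ 2) ^ (-(2 : ℝ))) * C ^ 2 / (Real.sqrt ρ * a)) := by
  have hc₃ : 0 < (∫ v : EuclideanSpace ℝ (Fin 3), (1 + ‖v‖ ^ 2) ^ (-(2 : ℝ))) := c₃_pos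
  -- names
  set s₀ : ℝ := -(4 * a ^ 2) with hs₀
  set s₁ : ℝ := -(N ^ 2 * a ^ 2) with hs₁
  set v : ℝ := ρ / (12 * a) with hv
  have hv0 : 0 < v := by positivity
  have hτ0 : τ < 0 := by nlinarith
  have hN0 : 0 < N := by linarith
  have hN2 : 4 ≤ N ^ 2 := by nlinarith
  have hs₁s₀ : s₁ ≤ s₀ := by
    rw [hs₁, hs₀]; nlinarith [mul_le_mul_of_nonneg_right hN2 (sq_nonneg a)]
  have hs₀τ : s₀ ≤ τ := hτ₁
  have hRτ : ρ * a / 2 - v * (τ + 4 * a ^ 2) ≤ ρ * a / 2 := by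
    have : 0 ≤ v * (τ + 4 * a ^ 2) := mul_nonneg hv0.le (by linarith)
    linarith
  -- the ancient Oseen inequality at `(τ, y)`, then name the kernel functional
  have hOseen' := hOseen τ hτ0 y
  set J : ℝ → ℝ≥0∞ := fun σ => ∫⁻ z, ENNReal.ofReal ((τ - σ + ‖y - z‖ ^ 2)⁻¹ ^ 2 * ‖u σ z‖ ^ 2)
    with hJ
  -- old times
  have hIO : ∫⁻ σ in Iio s₁, J σ ≤ ENNReal.ofReal (2 * Real.sqrt 2 * (∫ v : EuclideanSpace ℝ (Fin 3), (1 + ‖v‖ ^ 2) ^ (-(2 : ℝ))) * C ^ 2 / (N * a)) := by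
    calc ∫⁻ σ in Iio s₁, J σ
        ≤ ∫⁻ σ in Iio s₁, ENNReal.ofReal ((∫ v : EuclideanSpace ℝ (Fin 3), (1 + ‖v‖ ^ 2) ^ (-(2 : ℝ))) * C ^ 2 * (τ - σ) ^ (-(1 / 2 : ℝ)) * (-σ)⁻¹) := by
          refine setLIntegral_mono' measurableSet_Iio fun σ hσ => ?_
          have hσ' : σ < s₁ := hσ
          exact slice_old y hTypeI (by linarith) (by linarith)
      _ ≤ ENNReal.ofReal (2 * Real.sqrt 2 * ((∫ v : EuclideanSpace ℝ (Fin 3), (1 + ‖v‖ ^ 2) ^ (-(2 : ℝ))) * C ^ 2) / Real.sqrt (N ^ 2 * a ^ 2)) := by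
          rw [hs₁]
          exact lintegral_old_le ha
            (by nlinarith [mul_le_mul_of_nonneg_right (show (8 : ℝ) ≤ N ^ 2 by nlinarith) (sq_nonneg a)])
            hτ₁ (by positivity)
      _ = ENNReal.ofReal (2 * Real.sqrt 2 * (∫ v : EuclideanSpace ℝ (Fin 3), (1 + ‖v‖ ^ 2) ^ (-(2 : ℝ))) * C ^ 2 / (N * a)) := by
          rw [show N ^ 2 * a ^ 2 = (N * a) ^ 2 by ring, Real.sqrt_sq (by positivity)]
          ring_nf
  -- hypothesis times
  have hIM : ∫⁻ σ in Ico s₁ s₀, J σ ≤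
      ENNReal.ofReal (ε ^ 2 * A / a) + ENNReal.ofReal (2 * (∫ v : EuclideanSpace ℝ (Fin 3), (1 + ‖v‖ ^ 2) ^ (-(2 : ℝ))) * C ^ 2 * N ^ 2 / (ρ * a)) := by
    have hvol : volume (Ico s₁ s₀) = ENNReal.ofReal (s₀ - s₁) := Real.volume_Ico
    calc ∫⁻ σ in Ico s₁ s₀, J σ
        ≤ ∫⁻ σ in Ico s₁ s₀, (ENNReal.ofReal (ε ^ 2) *
            (∫⁻ z, ENNReal.ofReal ((τ - σ + ‖y - z‖ ^ 2)⁻¹ ^ 2 * (-σ)⁻¹)) +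
            ENNReal.ofReal (2 * (∫ v : EuclideanSpace ℝ (Fin 3), (1 + ‖v‖ ^ 2) ^ (-(2 : ℝ))) * C ^ 2 / (ρ * a ^ 3))) := by
          refine setLIntegral_mono' measurableSet_Ico fun σ hσ => ?_
          have h4 : 4 * a ^ 2 < -σ := by rw [hs₀] at hσ; linarith [hσ.2]
          exact slice_mid hC ha hρ hTypeI (by linarith [hσ.2]) h4 (hy.trans hRτ)
            (fun z hz => hhyp σ hσ.1 hσ.2 z hz)
      _ = ENNReal.ofReal (ε ^ 2) * (∫⁻ σ in Ico s₁ s₀, ∫⁻ z,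
            ENNReal.ofReal ((τ - σ + ‖y - z‖ ^ 2)⁻¹ ^ 2 * (-σ)⁻¹)) +
            ENNReal.ofReal (2 * (∫ v : EuclideanSpace ℝ (Fin 3), (1 + ‖v‖ ^ 2) ^ (-(2 : ℝ))) * C ^ 2 / (ρ * a ^ 3)) * volume (Ico s₁ s₀) := by
          rw [lintegral_add_right _ measurable_const, lintegral_const_mul' _ _ ENNReal.ofReal_ne_top,
            setLIntegral_const]
      _ ≤ ENNReal.ofReal (ε ^ 2) * ENNReal.ofReal (A / Real.sqrt (-τ)) +
            ENNReal.ofReal (2 * (∫ v : EuclideanSpace ℝ (Fin 3), (1 + ‖v‖ ^ 2) ^ (-(2 : ℝ))) * C ^ 2 / (ρ * a ^ 3)) * ENNReal.ofReal (s₀ - s₁) := by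
          rw [hvol]
          gcongr
          calc ∫⁻ σ in Ico s₁ s₀, ∫⁻ z, ENNReal.ofReal ((τ - σ + ‖y - z‖ ^ 2)⁻¹ ^ 2 * (-σ)⁻¹)
              ≤ ∫⁻ σ in Iio τ, ∫⁻ z, ENNReal.ofReal ((τ - σ + ‖y - z‖ ^ 2)⁻¹ ^ 2 * (-σ)⁻¹) :=
                lintegral_mono_set fun σ hσ => lt_of_lt_of_le hσ.2 hs₀τ
            _ ≤ ENNReal.ofReal (A / Real.sqrt (-τ)) := hT2 τ hτ0 y
      _ ≤ ENNReal.ofReal (ε ^ 2 * A / a) + ENNReal.ofReal (2 * (∫ v : EuclideanSpace ℝ (Fin 3), (1 + ‖v‖ ^ 2) ^ (-(2 : ℝ))) * C ^ 2 * N ^ 2 / (ρ * a)) := by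
          rw [← ENNReal.ofReal_mul (sq_nonneg ε), ← ENNReal.ofReal_mul (by positivity)]
          refine add_le_add (ENNReal.ofReal_le_ofReal ?_) (ENNReal.ofReal_le_ofReal ?_)
          · have hsa : a ≤ Real.sqrt (-τ) := by
              rw [show a = Real.sqrt (a ^ 2) by rw [Real.sqrt_sq ha.le]]
              exact Real.sqrt_le_sqrt (by linarith)
            rw [mul_div_assoc]
            exact mul_le_mul_of_nonneg_left (div_le_div_of_nonneg_left hA.le ha hsa) (sq_nonneg ε)
          · have hss : s₀ - s₁ ≤ N ^ 2 * a ^ 2 := by rw [hs₀, hs₁]; nlinarith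
            calc 2 * (∫ v : EuclideanSpace ℝ (Fin 3), (1 + ‖v‖ ^ 2) ^ (-(2 : ℝ))) * C ^ 2 / (ρ * a ^ 3) * (s₀ - s₁) ≤ 2 * (∫ v : EuclideanSpace ℝ (Fin 3), (1 + ‖v‖ ^ 2) ^ (-(2 : ℝ))) * C ^ 2 / (ρ * a ^ 3) * (N ^ 2 * a ^ 2) :=
                  mul_le_mul_of_nonneg_left hss (by positivity)
              _ = 2 * (∫ v : EuclideanSpace ℝ (Fin 3), (1 + ‖v‖ ^ 2) ^ (-(2 : ℝ))) * C ^ 2 * N ^ 2 / (ρ * a) := by field_simp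
  -- bootstrap times
  have hIB : ∫⁻ σ in Ico s₀ τ, J σ ≤
      ENNReal.ofReal (4 * (∫ v : EuclideanSpace ℝ (Fin 3), (1 + ‖v‖ ^ 2) ^ (-(2 : ℝ))) * η ^ 2 * a) +
        ENNReal.ofReal (32 * Real.sqrt 6 * (∫ v : EuclideanSpace ℝ (Fin 3), (1 + ‖v‖ ^ 2) ^ (-(2 : ℝ))) * C ^ 2 / (Real.sqrt ρ * a)) := by
    set K : ℝ := 4 * (∫ v : EuclideanSpace ℝ (Fin 3), (1 + ‖v‖ ^ 2) ^ (-(2 : ℝ))) * C ^ 2 / a ^ 2 * (2 * v) ^ (-(1 / 2 : ℝ)) with hK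
    have hK0 : 0 ≤ K := by positivity
    have hτs₀ : τ - s₀ ≤ 4 * a ^ 2 := by rw [hs₀]; linarith
    have hτs₀' : τ - s₀ ≤ 16 * a ^ 2 := by linarith [sq_nonneg a]
    have h1 : ∫⁻ σ in Ico s₀ τ, ENNReal.ofReal ((∫ v : EuclideanSpace ℝ (Fin 3), (1 + ‖v‖ ^ 2) ^ (-(2 : ℝ))) * η ^ 2 * (τ - σ) ^ (-(1 / 2 : ℝ))) ≤
        ENNReal.ofReal (4 * (∫ v : EuclideanSpace ℝ (Fin 3), (1 + ‖v‖ ^ 2) ^ (-(2 : ℝ))) * η ^ 2 * a) := by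
      refine (lintegral_Ico_rpow_neg_half_le (by positivity) (by positivity) hτs₀).trans (le_of_eq ?_)
      rw [show (4 : ℝ) * a ^ 2 = (2 * a) ^ 2 by ring, Real.sqrt_sq (by positivity)]
      ring_nf
    have h2 : ∫⁻ σ in Ico s₀ τ, ENNReal.ofReal (K * (τ - σ) ^ (-(3 / 4 : ℝ))) ≤
        ENNReal.ofReal (K * (8 * Real.sqrt a)) := by
      refine (lintegral_Ico_rpow_neg_three_quarters_le hK0 (by positivity) hτs₀').trans (le_of_eq ?_)
      rw [rpow_quarter_sixteen_mul_sq ha.le]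
      ring_nf
    -- `K · 8√a = 32 √6 c₃ C² / (√ρ a)`
    have hKval : K * (8 * Real.sqrt a) = 32 * Real.sqrt 6 * (∫ v : EuclideanSpace ℝ (Fin 3), (1 + ‖v‖ ^ 2) ^ (-(2 : ℝ))) * C ^ 2 / (Real.sqrt ρ * a) := by
      have h2v : 2 * v = ρ / (6 * a) := by rw [hv]; field_simp; ring
      have hr : (2 * v) ^ (-(1 / 2 : ℝ)) = Real.sqrt 6 * Real.sqrt a / Real.sqrt ρ := by
        rw [h2v, Real.rpow_neg (by positivity), ← Real.sqrt_eq_rpow, Real.sqrt_div' _ (by positivity),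
          inv_div, Real.sqrt_mul (by norm_num)]
      have hρ' : Real.sqrt ρ ≠ 0 := (Real.sqrt_pos.2 hρ).ne'
      have ha' : a ≠ 0 := ha.ne'
      rw [hK, hr]
      calc 4 * (∫ v : EuclideanSpace ℝ (Fin 3), (1 + ‖v‖ ^ 2) ^ (-(2 : ℝ))) * C ^ 2 / a ^ 2 * (Real.sqrt 6 * Real.sqrt a / Real.sqrt ρ) * (8 * Real.sqrt a)
          = 32 * Real.sqrt 6 * (∫ v : EuclideanSpace ℝ (Fin 3), (1 + ‖v‖ ^ 2) ^ (-(2 : ℝ))) * C ^ 2 * (Real.sqrt a * Real.sqrt a) / (a ^ 2 * Real.sqrt ρ) := by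
            field_simp
            ring
        _ = 32 * Real.sqrt 6 * (∫ v : EuclideanSpace ℝ (Fin 3), (1 + ‖v‖ ^ 2) ^ (-(2 : ℝ))) * C ^ 2 * a / (a ^ 2 * Real.sqrt ρ) := by rw [Real.mul_self_sqrt ha.le]
        _ = 32 * Real.sqrt 6 * (∫ v : EuclideanSpace ℝ (Fin 3), (1 + ‖v‖ ^ 2) ^ (-(2 : ℝ))) * C ^ 2 / (Real.sqrt ρ * a) := by
            rw [div_eq_div_iff (by positivity) (by positivity)]
            ring
    calc ∫⁻ σ in Ico s₀ τ, J σ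
        ≤ ∫⁻ σ in Ico s₀ τ, (ENNReal.ofReal ((∫ v : EuclideanSpace ℝ (Fin 3), (1 + ‖v‖ ^ 2) ^ (-(2 : ℝ))) * η ^ 2 * (τ - σ) ^ (-(1 / 2 : ℝ))) +
            ENNReal.ofReal (K * (τ - σ) ^ (-(3 / 4 : ℝ)))) := by
          refine setLIntegral_mono' measurableSet_Ico fun σ hσ => ?_
          have hσa : a ^ 2 < -σ := by linarith [hσ.2]
          exact slice_boot hC ha hv0 hTypeI hσ.2 hσa hy (by ring) (fun z hz => hboot σ hσ.1 hσ.2 z hz)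
      _ = (∫⁻ σ in Ico s₀ τ, ENNReal.ofReal ((∫ v : EuclideanSpace ℝ (Fin 3), (1 + ‖v‖ ^ 2) ^ (-(2 : ℝ))) * η ^ 2 * (τ - σ) ^ (-(1 / 2 : ℝ)))) +
            ∫⁻ σ in Ico s₀ τ, ENNReal.ofReal (K * (τ - σ) ^ (-(3 / 4 : ℝ))) := by
          refine lintegral_add_left ?_ _
          refine Measurable.ennreal_ofReal ?_
          fun_prop
      _ ≤ ENNReal.ofReal (4 * (∫ v : EuclideanSpace ℝ (Fin 3), (1 + ‖v‖ ^ 2) ^ (-(2 : ℝ))) * η ^ 2 * a) + ENNReal.ofReal (K * (8 * Real.sqrt a)) := add_le_add h1 h2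
      _ = _ := by rw [hKval]
  -- assemble
  have hsub : Iio τ ⊆ Iio s₁ ∪ Ico s₁ s₀ ∪ Ico s₀ τ := by
    intro σ hσ
    rcases lt_or_ge σ s₁ with h | h
    · exact Or.inl (Or.inl h)
    rcases lt_or_ge σ s₀ with h' | h'
    · exact Or.inl (Or.inr ⟨h, h'⟩)
    · exact Or.inr ⟨h', hσ⟩
  have hI : ∫⁻ σ in Iio τ, J σ ≤ ENNReal.ofReal (2 * Real.sqrt 2 * (∫ v : EuclideanSpace ℝ (Fin 3), (1 + ‖v‖ ^ 2) ^ (-(2 : ℝ))) * C ^ 2 / (N * a)) +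
      (ENNReal.ofReal (ε ^ 2 * A / a) + ENNReal.ofReal (2 * (∫ v : EuclideanSpace ℝ (Fin 3), (1 + ‖v‖ ^ 2) ^ (-(2 : ℝ))) * C ^ 2 * N ^ 2 / (ρ * a))) +
      (ENNReal.ofReal (4 * (∫ v : EuclideanSpace ℝ (Fin 3), (1 + ‖v‖ ^ 2) ^ (-(2 : ℝ))) * η ^ 2 * a) +
        ENNReal.ofReal (32 * Real.sqrt 6 * (∫ v : EuclideanSpace ℝ (Fin 3), (1 + ‖v‖ ^ 2) ^ (-(2 : ℝ))) * C ^ 2 / (Real.sqrt ρ * a))) :=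
    calc ∫⁻ σ in Iio τ, J σ ≤ ∫⁻ σ in Iio s₁ ∪ Ico s₁ s₀ ∪ Ico s₀ τ, J σ := lintegral_mono_set hsub
      _ ≤ (∫⁻ σ in Iio s₁ ∪ Ico s₁ s₀, J σ) + ∫⁻ σ in Ico s₀ τ, J σ := lintegral_union_le _ _ _
      _ ≤ (∫⁻ σ in Iio s₁, J σ) + (∫⁻ σ in Ico s₁ s₀, J σ) + ∫⁻ σ in Ico s₀ τ, J σ :=
          add_le_add (lintegral_union_le _ _ _) le_rfl
      _ ≤ _ := add_le_add (add_le_add hIO hIM) hIB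
  -- back to `ℝ`
  have h₁ : (0 : ℝ) ≤ 2 * Real.sqrt 2 * (∫ v : EuclideanSpace ℝ (Fin 3), (1 + ‖v‖ ^ 2) ^ (-(2 : ℝ))) * C ^ 2 / (N * a) := by positivity
  have h₂ : (0 : ℝ) ≤ ε ^ 2 * A / a := by positivity
  have h₃ : (0 : ℝ) ≤ 2 * (∫ v : EuclideanSpace ℝ (Fin 3), (1 + ‖v‖ ^ 2) ^ (-(2 : ℝ))) * C ^ 2 * N ^ 2 / (ρ * a) := by positivity
  have h₄ : (0 : ℝ) ≤ 4 * (∫ v : EuclideanSpace ℝ (Fin 3), (1 + ‖v‖ ^ 2) ^ (-(2 : ℝ))) * η ^ 2 * a := by positivity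
  have h₅ : (0 : ℝ) ≤ 32 * Real.sqrt 6 * (∫ v : EuclideanSpace ℝ (Fin 3), (1 + ‖v‖ ^ 2) ^ (-(2 : ℝ))) * C ^ 2 / (Real.sqrt ρ * a) := by positivity
  have hfin : ENNReal.ofReal ‖u τ y‖ ≤ ENNReal.ofReal (C₀ * (2 * Real.sqrt 2 * (∫ v : EuclideanSpace ℝ (Fin 3), (1 + ‖v‖ ^ 2) ^ (-(2 : ℝ))) * C ^ 2 / (N * a) +
      (ε ^ 2 * A / a + 2 * (∫ v : EuclideanSpace ℝ (Fin 3), (1 + ‖v‖ ^ 2) ^ (-(2 : ℝ))) * C ^ 2 * N ^ 2 / (ρ * a)) +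
      (4 * (∫ v : EuclideanSpace ℝ (Fin 3), (1 + ‖v‖ ^ 2) ^ (-(2 : ℝ))) * η ^ 2 * a + 32 * Real.sqrt 6 * (∫ v : EuclideanSpace ℝ (Fin 3), (1 + ‖v‖ ^ 2) ^ (-(2 : ℝ))) * C ^ 2 / (Real.sqrt ρ * a)))) := by
    refine hOseen'.trans ((mul_le_mul' le_rfl hI).trans (le_of_eq ?_))
    rw [ofReal_add_five h₁ h₂ h₃ h₄ h₅, ← ENNReal.ofReal_mul hC₀.le]
  have := (ENNReal.ofReal_le_ofReal_iff (by positivity)).1 hfin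
  linarith [this]

end Summit.NavierStokesRegularity.NavierStokesRegularity.Theorems.NearExtremalTransiencePerFlow.LocalKatoGap

end
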